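import Summits.BirchSwinnertonDyer.Rank1Residual.GaloisImage.KatoKuriharaPortThreeOfZetaBody
import Summits.BirchSwinnertonDyer.Rank1Residual.GaloisImage.KatoKuriharaValueRowsOfZetaBody
import HarnessLib

/-!
# ★ PK-6₂ ∘ T-PK6-VDIS: PORT″ at `t = 0` from `ZetaBody`, THEOREM D and the VALUE certificates
# (the T1 composition; cell `b2b-bsdres`, team n1011, seat p02 GEN 15; lead R5-119 (b) / R5-120 (b))

HONEST FRAMING (cell `b2b-bsdres`, run/shared/lean/b2b/bsd-rank1-residual/, verbatim in every
file): the goal of the cell is to DELETE the COMBINATION-SHAPED residual classes of the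
Birch–Swinnerton-Dyer formula for ALL analytic-rank `≤ 1` elliptic curves over `ℚ` — "full BSD
formula for every rank `≤ 1` curve in class `C`" assembled STRICTLY from published theorems — so
that the rank-`≤ 1` remainder becomes exactly the CONSTRUCTION-SHAPED classes, which are TYPED
(missing-input `Prop`s), NOT attempted. This is not "finishing BSD". Team n1011 (N10/N11; ROUTE 1,
the PORT anatomy (P-KIM) of class X4 ∧ `p = 3`): research route on CONSTRUCTION-SHAPED classes;
prove what is provable now; no claim beyond stated classes; census output = EVIDENCE, never a
Literature fact; RESIDUAL-MAP marks UNCHANGED; nothing is booked by this file.  END THEOREM WITH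
DISPLAYED HYPOTHESES — closes NO row by itself; 0 defs / 0 facts / 0 instances / 0 `sorry`.

## What
`katoKuriharaPortThreeAtWith₂_zero_of_zetaBody_of_valueRows`: n1011-p13's ★ PK-6₂ with its displayed
binder (e) `hvalue` (the per-level value rows) DISCHARGED by T-PK6-VDIS `ValueRow.valueRows_of_zetaBody`
(`hf := P.isNewformOf`). Displayed now: `P`, `hN`, `hbody` (bound once, passed whole), `hfin`, `hcdA`,
THEOREM D's `hbad`/`ht0`, and — replacing `hvalue` — `hirr`, R-κ (b) `hNorm`/`hκ0`, END-m1's guards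
`d′`/`hcd`/`hdd′`, the guards `hAN : gcd(A, N) = 1`, `hpN : 9 ∣ N` (additive at `3`), integer models
`aM` of `a_q(P.f)` (`q ∣ 3A`) with END-m1's certificates `hE0`/`hE`, `hR0`/`hR`, and `[NeZero A]`.
Conclusion unchanged: `KatoKuriharaPortThreeAtWith₂ W 0 v₃ η P`; HONEST LIMITS as in PK-6₂ (`t = 0`;
`hbad` excludes 3-anomalous bad places; nothing booked). Refs: Kato, Astérisque 295 (2004) §9.4, Thm. 9.7,
Thm. 6.6 (1), Ex. 13.3 [Kato2004Asterisque]; Kim, AJM 148 = arXiv:2203.12159 Thm. 3.13 [Kim2022StructureSelmer];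
`cells/n1011/ROUTE-1.md` §58/§60; p13 GEN 14 close line (T1); lead R5-119 (b) / R5-120 (b).
-/

noncomputable section

open scoped NumberField TensorProduct Classical
open Field Finset IsDedekindDomain NumberField WeierstrassCurve Rat.HeightOneSpectrum
open Literature.NumberTheory.GaloisRepresentations Literature.NumberTheory.GaloisCohomology
open Literature.NumberTheory.GaloisRepresentations.DiscreteGaloisModule
open Literature.NumberTheory.EllipticCurves Literature.NumberTheory.EllipticCurves.ModularForms
open Literature.NumberTheory.EllipticCurves.Kato2004
open Literature.NumberTheory.EllipticCurves.Kato2004.EulerSystemValues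

namespace Summit.BirchSwinnertonDyer.Rank1Residual.GaloisImage

variable (W : WeierstrassCurve ℚ) [W.IsElliptic] [W.IsGloballyMinimal]
  [ContinuousSMul ℤ_[3] (W.tateModule 3)] [Module.Free ℤ_[3] (W.tateModule 3)]
  [Module.Finite ℤ_[3] (W.tateModule 3)]

/-- **★ PK-6₂ with the value rows discharged**: PORT″ `KatoKuriharaPortThreeAtWith₂ W 0 v₃ η P` from
`ZetaBody` (displayed `hbody`), the riders `hfin`, `hcdA`, THEOREM D's certificates `hbad`/`ht0`, and
the level-free VALUE certificates of T-PK6-VDIS (`hirr`, `hNorm`/`hκ0`, `d′`/`hcd`/`hdd′`, `hAN`, `hpN`,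
`aM`/`haM`, `hE0`/`hE`, `hR0`/`hR`) — ★ PK-6₂ ∘ `ValueRow.valueRows_of_zetaBody` (`hf := P.isNewformOf`).
[cite: Kato2004Asterisque, §9.4 (p. 188), Thm. 9.7 (p. 189), Thm. 6.6 (1) (p. 163) and Ex. 13.3 (pp. 224–225)]
[cite: Kim2022StructureSelmer, Thm. 3.13 and its proof (arXiv v3 pp. 12, 26–28)] -/
theorem katoKuriharaPortThreeAtWith₂_zero_of_zetaBody_of_valueRows
    {N : ℕ} [NeZero N] (P : ModularParametrizationData W N) (hN : N = W.conductorNorm ℤ)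
    {ι : (n : ℕ) → (CyclotomicField n ℚ →+* ℂ)} {κK : ℝ}
    {Λ : ∀ (k' : ℕ) (r : Finset (HeightOneSpectrum (𝓞 ℚ))),
      H1 (tateRep W 3) (cycSubgroup 3 k' r) →ₗ[ℤ_[3]] ℚ_[3] ⊗[ℚ] CyclotomicField (cycLevel 3 k' r) ℚ}
    {c d a : ℤ} {A : ℕ} [NeZero A]
    {z : ∀ (k' : ℕ) (r : (cyclotomicLevelsRat 3 (badPlaces c d A N)).Ideals),
      H1 (tateRep W 3) ((cyclotomicLevelsRat 3 (badPlaces c d A N)).level k' r.1)}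
    {x : ∀ (k' : ℕ) (r : (cyclotomicLevelsRat 3 (badPlaces c d A N)).Ideals),
      CyclotomicField (cycLevel 3 k' r.1) ℚ}
    (hbody : ZetaBody W 3 P.f ι κK Λ c d a A z x)
    {v₃ : HeightOneSpectrum (𝓞 ℚ)}
    (Λfin : ∀ j : ℕ, galoisCohomology ((W.torsionGaloisModule (((3 : ℕ) : ℤ) ^ j * ((3 : ℕ) : ℤ))).toLocal
      (Sum.inr v₃)) 1 →+ ZMod (3 ^ (j + 1)))
    (hfin : ∀ j : ℕ, KatoExpStarFiniteLevelAt W 3 j 0 v₃ Λ (Λfin j))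
    {η : (q : HeightOneSpectrum (𝓞 ℚ)) → (ZMod (Ideal.absNorm q.asIdeal))ˣ}
    (hcdA : ∀ q : ℕ, q.Prime → q ≡ 1 [MOD 3] → ¬ q ∣ 2 * c.natAbs * d.natAbs * A)
    (hbad : ∀ w : HeightOneSpectrum (𝓞 ℚ), ¬ W.HasGoodReductionAt w →
      ((primesEquiv w : Nat.Primes) : ℕ) ≠ 3 →
        ∀ Q : (W.baseChange (w.adicCompletion ℚ)).toAffine.Point, 3 • Q = 0 → Q = 0)
    (ht0 : ∀ w : HeightOneSpectrum (𝓞 ℚ), ((3 : ℕ) : 𝓞 ℚ) ∈ w.asIdeal →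
        ∀ Q : (W.baseChange (w.adicCompletion ℚ)).toAffine.Point, 3 • Q = 0 → Q = 0)
    -- the VALUE certificates (T-PK6-VDIS), replacing ★ PK-6₂'s displayed `hvalue`
    (hirr : W.HasIrreducibleModPGaloisRep 3)
    (hNorm : ∃ u : ℚ, (u : ℝ) = κK ∧ padicValRat 3 u = 0) (hκ0 : κK ≠ 0)
    (d' : ℤ) (hcd : Int.gcd (c * d) A = 1) (hdd' : d * d' ≡ 1 [ZMOD (A : ℤ)])
    (hAN : Nat.Coprime A N) (hpN : 3 ^ 2 ∣ N)
    (aM : ℕ → ℤ) (haM : ∀ q ∈ (3 * A).primeFactors, cuspCoeff P.f q = aM q)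
    (hE0 : ∏ q ∈ (3 * A).primeFactors, (1 - (aM q : ℚ) / q + (if q ∣ N then 0 else (1 / q : ℚ))) ≠ 0)
    (hE : padicValRat 3
      (∏ q ∈ (3 * A).primeFactors, (1 - (aM q : ℚ) / q + (if q ∣ N then 0 else (1 / q : ℚ)))) = 0)
    (hR0 : (c : ℚ) ^ 2 * (d : ℚ) ^ 2 * ratMinusSymbol P.f ((a : ℚ) / A) -
        (c : ℚ) * (d : ℚ) ^ 2 * ratMinusSymbol P.f ((a * c : ℚ) / A) -
        (c : ℚ) ^ 2 * (d : ℚ) * ratMinusSymbol P.f ((a * d' : ℚ) / A) +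
        (c : ℚ) * (d : ℚ) * ratMinusSymbol P.f ((a * c * d' : ℚ) / A) ≠ 0)
    (hR : padicValRat 3 ((c : ℚ) ^ 2 * (d : ℚ) ^ 2 * ratMinusSymbol P.f ((a : ℚ) / A) -
        (c : ℚ) * (d : ℚ) ^ 2 * ratMinusSymbol P.f ((a * c : ℚ) / A) -
        (c : ℚ) ^ 2 * (d : ℚ) * ratMinusSymbol P.f ((a * d' : ℚ) / A) +
        (c : ℚ) * (d : ℚ) * ratMinusSymbol P.f ((a * c * d' : ℚ) / A)) = 0) :
    KatoKuriharaPortThreeAtWith₂ W 0 v₃ η P :=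
  katoKuriharaPortThreeAtWith₂_zero_of_zetaBody W P hN hbody Λfin hfin hcdA hbad ht0
    (ValueRow.valueRows_of_zetaBody hbody P.isNewformOf (by decide) hirr hNorm hκ0 d' hcd hdd' hAN hpN
      aM haM hE0 hE hR0 hR η)

end Summit.BirchSwinnertonDyer.Rank1Residual.GaloisImage
end
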